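import Summits.FinalStateConjecture.FinalStateConjecture.Theses.ZeroEnergyKerrOrBomb
import Literature.Geometry.Lorentzian.KillingModeStability
import Literature.Geometry.Lorentzian.LinearizedRicci
import Literature.Geometry.Lorentzian.StationaryFinalStateDecomposition
import Literature.Geometry.Lorentzian.KerrDataProofs
import Literature.Geometry.Lorentzian.KerrSchildCoord
import Literature.Geometry.Lorentzian.LeviCivitaProofs

/-!
# Line `one-locked-explosion` — checked skeleton for crux `StationaryLimitReduction`

Crux item stmt-FinalStateConjecture-10021 of route `ZeroEnergyKerrOrBomb`:
`StationaryLimitReduction : Prop := KerrOrBomb → FinalStateConjecture` (rank 4; the decl is the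
route's and is concluded BY NAME by `StationaryLimitReduction_of` below).

Idea card `Cruxes/StationaryLimitReduction/Ideas/one-locked-explosion.md` (crux-ideate r1,
ideator 1; triage r1-1/2/3: pass ×3, merged with `escape-along-the-explosion`), line card
`Lines/one-locked-explosion.md`.

## The line in one paragraph

Genericity is curve-genericity (`IsChristodoulouGeneric … 1`), and goodness on a PUNCTURED
parameter neighbourhood is enough (`stub_localEscapeSuffices`). Every admissible datum either is
good, or escapes locally, or all its MGHDs settle exhaustively IN `C¹` to admissible stationary vacuum
holes (`stub_settleOrEscape` — censorship + settling + third law, the debt shared by every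
stationary-limit line); if all limit holes are (fact-free) Kerr exteriors the datum is good or
escapes (`stub_kerrLimitsAreGood`: Kerr chart transfer plus the `C¹ → C²` upgrade / far-field
cleaning that Disproof §7 forces on every settling line). Otherwise some limit hole `𝓑` is not Kerr,
hence — THIS is where the crux hypothesis `KerrOrBomb` is consumed, by contraposition — not
Killing-mode stable for `□_g`;
the spin-raising bridge (`stub_spinRaisingBridge`) turns the scalar bomb into a growing,
horizon-regular, outgoing, non-gauge TENSOR Killing mode of linearised gravity, whose spectrum has
an attained, isolated, simple top rate `ν₁` (`stub_topModeGap`, H1). ONE explosion of `𝓑` along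
the top mode has a good future (`stub_oneGoodExplosion`: an admissible exit datum `e` whose MGHD
converges to `𝓑` in the chart past at rate `e^{ν₁ t}` and which itself satisfies the summit
property), and the LOCK (`stub_lockedEscape`): kicking the datum along a flat, phase-locked,
admissible curve `s ↦ D ⊕ e^{-1/s²}(cos(α/s²) w₁ + sin(α/s²) w₂) ⊕ s e^{-1/s²} w₃` ejects every
non-Kerr limit hole along its CHOSEN good explosion for all small `s ≠ 0`, and capture (Cauchy
stability on the compact stretch + sub-extremal Kerr stability at the explosions' ends) makes the
punctured curve good. `StationaryLimitReduction_of` is the kernel-checked composition (pure logic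
plus the tree theorems `Kerr.Facts` / `hasLeviCivita` needed to instantiate `KerrOrBomb` on a hole).

## Disproof.lean used (cdisprove cycles 1–2, read 2026-08-16T02:17Z version)

* `without_iff_summit`: the crux has ONE hypothesis; no `_false_without_` theorem exists, none is
  claimed. Where `KerrOrBomb` is used: exactly once, in `StationaryLimitReduction_of`, to certify
  that a non-Kerr admissible limit hole is not Killing-mode stable (the seed of the bridge).
* §5 `genericity_not_and_closed`: honoured — no two generic clauses are ever intersected; every
  stub that produces a curve produces ONE curve per bad datum into the FULLY good set
  (`HasLocalEscape … (SummitProperty X)`), and `stub_settleOrEscape` is a pointwise trichotomy,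
  not a genericity statement.
* §6 note 1 (scalar typing of mode stability): carried as its own stub `stub_spinRaisingBridge`,
  typed WITH horizon regularity, an outgoing clause and a non-gauge clause (triage r1-1 (a),
  r1-3 (a)). §6 notes 2–3 (non-degenerate connected horizon, global horizon Killing field h3 of
  the telescope): inside `InTelescope`, demanded of the limit holes by `stub_settleOrEscape`
  (recorded as that stub's third-law / rigidity-of-the-limit debt, not hidden).
* §4 `StationaryLimitReductionPointwise` (FALSE by §7, near-miss `not_finalStatePointwise`): not used
  — the line is generic-only, and no stub asserts the summit property pointwise of a datum it did
  not construct: stub 3 concludes `SummitProperty ∨ HasLocalEscape`, stubs 2/7 conclude escapes,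
  stub 6 asserts it of an exit datum of the prover's choosing.
* §7 (cycle 2, far-field FOCUSING packets: `(2,1)` admissibility protects late-time `C¹`, not the
  summit's `C²`; every pointwise `C²` settling/capture stub over `admissibleVacuumData` is false on
  a DR-dense set; repaired shape `summit_of_pointwiseOn_of_escape`): honoured — `SettlesTo` is `C¹`
  (`StationaryFinalStateDecomposition … 1`), so data `D + packets` still settle and reach stub 7 or
  stub 3, which clean the far field ALONG THEIR CURVES (Kerr end glued outside `ρ(c) = e^{2/c²}`);
  the `C¹ → C²` upgrade for far-regular data is named inside stubs 3 and 7.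
* Landed Negative lemma `Theorems/StationaryLimitReduction/Negative/KillShape.lean` (p72863):
  §1/§3 logic only; no stub below is an instance it refutes (none asserts `¬ FinalStateConjecture`
  or a uniform failure of the summit property).

Nothing in §0 asserts anything: the vocabulary consists of abbreviations over existing
declarations (`admissibleVacuumData`, `IsSmoothDataFamily`, `StationaryFinalStateDecomposition`,
`AdaptedChart`, `truncDeviationCk`, `linearizedRicciCLM`, `lieDerivBilin`, `IsKillingModeStable`,
the summit's `HasCompleteNullInfinity` / `exteriorOf` / `HasExhaustiveCharts`).
-/

set_option linter.dupNamespace false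

noncomputable section

open scoped Manifold ContDiff Topology ENNReal
open Set Filter Bundle Literature.Geometry.Lorentzian

namespace Summit.FinalStateConjecture.FinalStateConjecture.Cruxes.StationaryLimitReduction.OneLockedExplosion

/-! ## §0 Vocabulary (definitions over existing declarations; nothing is asserted) -/

/-- `Kerr.Facts` holds outright (tree theorems `Kerr.isConnected_region_holds`,
`Kerr.contMDiff_bilin_holds`, `Kerr.contMDiff_timeVector_holds`); needed to instantiate the
route's target `KerrOrBomb` on an abstract hole and to spell its conclusion. -/
theorem kerrFacts : Kerr.Facts :=
  ⟨Kerr.isConnected_region_holds, Kerr.contMDiff_bilin_holds, Kerr.contMDiff_timeVector_holds⟩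

section Data

variable {X : Type} [TopologicalSpace X] [ChartedSpace E3 X] [IsManifold (𝓡 3) ∞ X]

/-- **Local escape** of the datum `d` into the property `P` inside the admissible class `𝓓`: an
admissible, jointly smooth, injective one-parameter family through `d` all of whose members with
parameter in a PUNCTURED NEIGHBOURHOOD of `0` satisfy `P` (the shape `stub_localEscapeSuffices`
reparametrises into `IsChristodoulouGeneric 𝓓 P 1`). -/
def HasLocalEscape (𝓓 : Set (InitialDataSet (𝓡 3) X)) (P : InitialDataSet (𝓡 3) X → Prop)
    (d : InitialDataSet (𝓡 3) X) : Prop :=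
  ∃ F : EuclideanSpace ℝ (Fin 1) → InitialDataSet (𝓡 3) X,
    InitialDataSet.IsSmoothDataFamily 1 F ∧ F 0 = d ∧ Function.Injective F ∧ (∀ c, F c ∈ 𝓓) ∧
      ∃ ε : ℝ, 0 < ε ∧ ∀ c, c ≠ 0 → ‖c‖ < ε → P (F c)

end Data

section Summit

variable (X : Type) [TopologicalSpace X] [ChartedSpace E3 X] [IsManifold (𝓡 3) ∞ X]
  [T2Space X] [SecondCountableTopology X] [ConnectedSpace X]

/-- The property the summit asserts generically of an admissible datum `D` on `X` — VERBATIM the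
lambda of `FinalStateConjecture` (so that `summit_iff` below is `Iff.rfl`): an MGHD exists, and
every MGHD has complete `𝓘⁺` and an exhaustive sub-extremal `N`-Kerr final-state decomposition of
its self-determined exterior. -/
def SummitProperty (D : InitialDataSet (𝓡 3) X) : Prop :=
  (∃ 𝒟 : VacuumCauchyDevelopment D, 𝒟.IsMaximal) ∧
    ∀ 𝒟 : VacuumCauchyDevelopment D, 𝒟.IsMaximal →
      Summit.FinalStateConjecture.HasCompleteNullInfinity 𝒟.toCauchyDevelopment ∧
        ∃ (O : Set 𝒟.carrier) (d : FinalStateDecomposition 𝒟.toSpacetime O 2),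
          (∀ i, Kerr.IsSubextremal (d.mass i) (d.spin i)) ∧
            O = Summit.FinalStateConjecture.exteriorOf 𝒟.toCauchyDevelopment d.charted ∧
              Summit.FinalStateConjecture.HasExhaustiveCharts d

end Summit

/-- The summit unfolded through `SummitProperty` (definitional). -/
theorem summit_iff :
    _root_.FinalStateConjecture ↔
      ∀ (X : Type) [TopologicalSpace X] [ChartedSpace E3 X] [IsManifold (𝓡 3) ∞ X] [T2Space X]
        [SecondCountableTopology X] [ConnectedSpace X],
        InitialDataSet.IsChristodoulouGeneric (admissibleVacuumData X) (SummitProperty X) 1 :=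
  Iff.rfl

section Holes

/-- **The telescope of the route's target** on a stationary AF black hole `𝓑` (verbatim the
hypotheses of `KerrOrBomb` before mode stability, the Levi-Civita connection being the
one the tree proves to exist, `hasLeviCivita`): vacuum, connected future event horizon,
non-degenerate horizon (h3: a global Killing field null on `𝓔⁺` — for a rotating limit hole this is
rigidity of the limit, Disproof §6 note 3), globally hyperbolic carrier, `T ≠ 0` on the d.o.c. -/
def InTelescope (𝓑 : StationaryAFBlackHole.{0}) : Prop :=
  haveI : 𝓑.metric.HasLeviCivita := 𝓑.metric.toPseudoRiemannianMetric.hasLeviCivita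
  𝓑.metric.toPseudoRiemannianMetric.IsRicciFlat ∧ IsConnected 𝓑.horizon ∧
    𝓑.toSpacetime.IsNonDegenerateHorizon 𝓑.Mext ∧
      𝓑.metric.IsGloballyHyperbolic 𝓑.timeOrientation ∧ ∀ p ∈ 𝓑.doc, 𝓑.killing p ≠ 0

/-- **`𝓑` is a (fact-free) sub-extremal Kerr exterior** — VERBATIM the conclusion of `KerrOrBomb`
(rev 4): `∃ |a| < M` and a smooth injective isometric immersion of the ingoing Kerr–Schild exterior
chart `(Kerr.exterior M a, Kerr.smoothMetric M a r₊)` into `𝓑` with range the d.o.c.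
(`Kerr.Facts`, needed to spell `Kerr.smoothMetric`, is the tree theorem `kerrFacts`.) -/
def IsKerrExterior (𝓑 : StationaryAFBlackHole.{0}) : Prop :=
  haveI : Kerr.Facts := kerrFacts
  ∃ (M a : ℝ), Kerr.IsSubextremal M a ∧ ∃ Ψ : Kerr.exterior M a → 𝓑.carrier,
    Function.Injective Ψ ∧ Set.range Ψ = 𝓑.doc ∧
      PseudoRiemannianMetric.IsIsometricImmersion
        (Kerr.smoothMetric M a (Kerr.rPlus M a)).toPseudoRiemannianMetric
        𝓑.metric.toPseudoRiemannianMetric Ψ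

/-- The `T`-adapted chart `A` of `𝓑` is **asymptotically Cartesian with spacelike leaves**
(Alexakis–Ionescu–Klainerman's `Φ₀`, arXiv:0904.0982 §1.1 GR/AF; the ingoing Kerr–Schild chart of
Kerr is the model): the chart components of `g_𝓑` tend to `η` as the chart radius `→ ∞` (they are
time independent, `T` being Killing), and every leaf `{x⁰ = τ}` is spacelike, so that the leaves are
asymptotically CAUCHY hypersurfaces of the charted region (not hyperboloidal: `dx⁰` stays timelike
far out). Demanded of the limit holes' charts in `SettlesTo` and of the explosion's chart in
`IsExplosionExit`; it is what makes "uniformly small on whole early leaves" mean "on the unstable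
manifold". -/
def ChartIsAsymptoticallyCartesian {𝓑 : StationaryAFBlackHole.{0}} (A : 𝓑.AdaptedChart) : Prop :=
  (∀ ε : ℝ, 0 < ε → ∃ R₀ : ℝ, ∀ x : A.domain, R₀ ≤ A.radius x.1 → ‖A.bilin x.1 - Minkowski.bilin‖ ≤ ε) ∧
    ∀ x : A.domain, ∀ v : E4, v 0 = 0 → v ≠ 0 → 0 < A.bilin x.1 v v

variable (𝓑 : StationaryAFBlackHole.{0})

/-- A field of continuous bilinear forms on `T𝓑` (a metric perturbation) is **smooth on `U`** as a
section of the bundle `Hom(TM, Hom(TM, ℝ))` (verbatim the smoothness notion of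
`InitialDataSet.contMDiff_k`, restricted to `U`). -/
def IsSmoothBilinOn
    (h : Π x : 𝓑.carrier, TangentSpace (𝓡 4) x →L[ℝ] TangentSpace (𝓡 4) x →L[ℝ] ℝ)
    (U : Set 𝓑.carrier) : Prop :=
  ContMDiffOn (𝓡 4) ((𝓡 4).prod 𝓘(ℝ, E4 →L[ℝ] E4 →L[ℝ] ℝ)) ∞
    (fun x ↦ TotalSpace.mk' (E4 →L[ℝ] E4 →L[ℝ] ℝ) x (h x)) U

/-- A vector field on `𝓑` is **smooth on `U`** (as a section of the tangent bundle). -/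
def IsSmoothVectorFieldOn (Y : Π x : 𝓑.carrier, TangentSpace (𝓡 4) x) (U : Set 𝓑.carrier) :
    Prop :=
  ContMDiffOn (𝓡 4) (𝓡 4).tangent ∞ (fun x ↦ (⟨x, Y x⟩ : TangentBundle (𝓡 4) 𝓑.carrier)) U

/-- The perturbation `h` is **pure gauge on the d.o.c.**: `h = 𝓛_Y g` there for some vector field
`Y` smooth on an open neighbourhood of `d.o.c. ∪ 𝓗⁺` (Wald 1984, (C.2.15)–(C.2.17); smoothness of
`Y` is demanded so that `lieDerivBilin Y g` is not an `mfderiv`-junk value). -/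
def IsPureGaugeOnDoc
    (h : Π x : 𝓑.carrier, TangentSpace (𝓡 4) x →L[ℝ] TangentSpace (𝓡 4) x →L[ℝ] ℝ) : Prop :=
  haveI : 𝓑.metric.HasLeviCivita := 𝓑.metric.toPseudoRiemannianMetric.hasLeviCivita
  ∃ (U : Set 𝓑.carrier) (Y : Π x : 𝓑.carrier, TangentSpace (𝓡 4) x),
    IsOpen U ∧ 𝓑.doc ∪ 𝓑.horizon ⊆ U ∧ IsSmoothVectorFieldOn 𝓑 Y U ∧
      ∀ x ∈ 𝓑.doc, h x = 𝓑.metric.toPseudoRiemannianMetric.lieDerivBilin Y 𝓑.metric.val x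

/-- **`(h₁, h₂)` is a TENSOR Killing-mode pair of frequency `ν + iω` of linearised gravity about
`𝓑`, regular at `𝓗⁺` and outgoing** — the spin-2 twin of `StationaryAFBlackHole.IsKillingModePair`
(scalar `□_g`, KillingModeStability.lean), with the side conditions the triage panel asked for
(r1-1 (a), r1-3 (a)): (i) `h₁, h₂` are smooth symmetric `2`-tensor fields on an open set
`U ⊇ d.o.c. ∪ 𝓗⁺` (regularity ACROSS the future horizon, Warnick's convention); (ii) they solve
linearised vacuum gravity `DRic_g(hᵢ) = 0` on the d.o.c. (`linearizedRicciCLM`, Wald (7.5.15));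
(iii) they are an eigenpair of the stationary Killing field, `𝓛_T h₁ = ν h₁ − ω h₂`,
`𝓛_T h₂ = ω h₁ + ν h₂` on the d.o.c. (real and imaginary parts of `𝓛_T h = (ν + iω) h`, so `h`
grows like `e^{νt}` along the flow); (iv) OUTGOING: on the far part `{R + 1 ≤ ‖y‖}` of the
asymptotically flat slice end of `𝓑` (read in the end's own Cartesian chart `𝓑.e.dataChart`,
composed with the slice embedding) the time–time component `h(T, T)`, the time–tangential
components `h(T, dΦ ·)` and the tangential components `Φ^* h` are bounded — for `ν > 0` this keeps
the branch `e^{s(t − r*)}` and kills the incoming branch `e^{s(t + r*)}`, which grows like `e^{ν r}`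
along the slice (Shlapentokh-Rothman, CMP 329 (2014), §3), exactly as the boundedness clause of the
scalar notion does; the values of a `T`-eigenfield on the slice determine it on the stationary orbit
of the slice. -/
def IsTensorModePair (ν ϖ : ℝ)
    (h₁ h₂ : Π x : 𝓑.carrier, TangentSpace (𝓡 4) x →L[ℝ] TangentSpace (𝓡 4) x →L[ℝ] ℝ) :
    Prop :=
  haveI : 𝓑.metric.HasLeviCivita := 𝓑.metric.toPseudoRiemannianMetric.hasLeviCivita
  (∃ U : Set 𝓑.carrier, IsOpen U ∧ 𝓑.doc ∪ 𝓑.horizon ⊆ U ∧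
      IsSmoothBilinOn 𝓑 h₁ U ∧ IsSmoothBilinOn 𝓑 h₂ U) ∧
    (∀ x ∈ 𝓑.doc, ∀ v w : TangentSpace (𝓡 4) x, h₁ x v w = h₁ x w v ∧ h₂ x v w = h₂ x w v) ∧
    (∀ x ∈ 𝓑.doc, 𝓑.metric.toPseudoRiemannianMetric.linearizedRicciCLM h₁ x = 0 ∧
      𝓑.metric.toPseudoRiemannianMetric.linearizedRicciCLM h₂ x = 0) ∧
    (∀ x ∈ 𝓑.doc,
      𝓑.metric.toPseudoRiemannianMetric.lieDerivBilin 𝓑.killing h₁ x = ν • h₁ x - ϖ • h₂ x ∧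
        𝓑.metric.toPseudoRiemannianMetric.lieDerivBilin 𝓑.killing h₂ x = ϖ • h₁ x + ν • h₂ x) ∧
    ∃ C : ℝ, ∀ y : exteriorRegion 𝓑.e.R, 𝓑.e.R + 1 ≤ ‖(y : E3)‖ →
      let Φ : exteriorRegion 𝓑.e.R → 𝓑.carrier := 𝓑.embed ∘ 𝓑.e.dataChart
      |h₁ (Φ y) (𝓑.killing (Φ y)) (𝓑.killing (Φ y))| ≤ C ∧
        |h₂ (Φ y) (𝓑.killing (Φ y)) (𝓑.killing (Φ y))| ≤ C ∧
      ‖(show E3 →L[ℝ] ℝ from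
          (h₁ (Φ y) (𝓑.killing (Φ y))).comp (mfderiv 𝓘(ℝ, E3) (𝓡 4) Φ y))‖ ≤ C ∧
        ‖(show E3 →L[ℝ] ℝ from
          (h₂ (Φ y) (𝓑.killing (Φ y))).comp (mfderiv 𝓘(ℝ, E3) (𝓡 4) Φ y))‖ ≤ C ∧
      ‖(show E3 →L[ℝ] E3 →L[ℝ] ℝ from pullbackBilin (I := 𝓡 4) (I' := 𝓘(ℝ, E3)) Φ h₁ y)‖ ≤ C ∧
        ‖(show E3 →L[ℝ] E3 →L[ℝ] ℝ from pullbackBilin (I := 𝓡 4) (I' := 𝓘(ℝ, E3)) Φ h₂ y)‖ ≤ C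

/-- **`𝓑` carries an exponentially growing tensor Killing mode**: a tensor Killing-mode pair with
`ν > 0` whose real part is not pure gauge on the d.o.c. — the conclusion of the spin-raising bridge
(`stub_spinRaisingBridge`). -/
def HasGrowingTensorMode : Prop :=
  ∃ (ν ϖ : ℝ) (h₁ h₂ : Π x : 𝓑.carrier, TangentSpace (𝓡 4) x →L[ℝ] TangentSpace (𝓡 4) x →L[ℝ] ℝ),
    0 < ν ∧ IsTensorModePair 𝓑 ν ϖ h₁ h₂ ∧ ¬ IsPureGaugeOnDoc 𝓑 h₁

/-- **`ν₁` is the attained, isolated, SIMPLE top growth rate of `𝓑`** (hypothesis H1 of the card,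
sharpened by triage r1-1 (c) and r1-3 (b)): there is a non-gauge tensor Killing-mode pair
`(h₁, h₂)` of frequency `ν₁ + iω₁`, `ν₁ > 0`, and a gap `δ > 0` such that every non-gauge tensor
Killing-mode pair `(k₁, k₂)` with rate `ν > ν₁ − δ` has rate exactly `ν₁`, frequency `±ω₁`, and
real part in the real span of `h₁, h₂` modulo gauge (`k₁ = α h₁ + β h₂ + 𝓛_Y g` on the d.o.c.):
the top eigenvalue is a single complex pair, so the strong-unstable manifold is a real `2`-plane
times the flow and the explosions of `𝓑` along it form ONE circle. -/
def IsSimpleTopRate (ν₁ : ℝ) : Prop :=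
  ∃ (ϖ₁ : ℝ) (h₁ h₂ : Π x : 𝓑.carrier, TangentSpace (𝓡 4) x →L[ℝ] TangentSpace (𝓡 4) x →L[ℝ] ℝ),
    0 < ν₁ ∧ IsTensorModePair 𝓑 ν₁ ϖ₁ h₁ h₂ ∧ ¬ IsPureGaugeOnDoc 𝓑 h₁ ∧
      ∃ δ : ℝ, 0 < δ ∧
        ∀ (ν ϖ : ℝ)
          (k₁ k₂ : Π x : 𝓑.carrier, TangentSpace (𝓡 4) x →L[ℝ] TangentSpace (𝓡 4) x →L[ℝ] ℝ),
          IsTensorModePair 𝓑 ν ϖ k₁ k₂ → ¬ IsPureGaugeOnDoc 𝓑 k₁ → ν₁ - δ < ν →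
            ν = ν₁ ∧ (ϖ = ϖ₁ ∨ ϖ = -ϖ₁) ∧
              ∃ α β : ℝ, IsPureGaugeOnDoc 𝓑 (fun x ↦ k₁ x - (α • h₁ x + β • h₂ x))

/-- **`e` is an exit datum of a TOP-MODE EXPLOSION of `𝓑` (rate `ν`)**: `e` is an admissible vacuum
datum on the `3`-manifold `Y` with a maximal vacuum Cauchy development `𝒟` which, read through a
smooth injective chart map `Ψ` on the domain of an ASYMPTOTICALLY CARTESIAN `T`-adapted chart `A`
of `𝓑` (`StationaryAFBlackHole.AdaptedChart`: chart time = Killing parameter, covering the d.o.c.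
of `𝓑` plus at most a horizon collar; `A.bilin → η` as `r → ∞` and the leaves `{t = τ}` are
SPACELIKE, so that they are asymptotically Cauchy hypersurfaces of the charted region —
Alexakis–Ionescu–Klainerman's `Φ₀`; a chart WITHOUT collar is allowed and is the expected choice
for a one-ended `e`, whose development need not contain `𝓑`'s early interior collar), (i) lies in
the chronological PAST
of the Cauchy hypersurface `ι(Y)` on all sufficiently early truncated slabs `{t = τ, r ≤ R}` (so
the convergence below happens towards the past of the datum and the chart is not time-reversed: a
future-inextendible `T`-line cannot stay in `I⁻(ι Y)`), (ii) converges to `𝓑` in `C²` UNIFORMLY ON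
THE WHOLE LEAVES `{t = τ}` as chart time `τ → −∞`, AT THE EXPONENTIAL RATE `ν`
(`deviationCk ≤ C e^{ν τ}` for `τ ≤ 0`, one `C` for all radii: an outgoing top mode is `≲ e^{ν τ}`
along asymptotically Cauchy leaves and the radiation it emitted earlier is smaller still; the
full-leaf form rules out spurious "explosions" made of `𝓑` plus incoming radiation from `𝓘⁻`,
whose trace on early leaves decays only like `1/r`; with `ν` the simple top rate it also excludes
the slower directions of the unstable manifold, which decay like `e^{ν' τ} ≫ e^{ν τ}` towards the
past, and so places the orbit on the top circle), and (iii) is not `𝓑` itself (some leaf deviation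
is non-zero). This is the ancient vacuum solution `Re(e^{iθ} e^{s₁ t} h₁) + O(e^{2ν₁ t})` of the
card, presented by Cauchy data at an exit time. -/
def IsExplosionExit (ν : ℝ) (Y : Type) [TopologicalSpace Y] [ChartedSpace E3 Y]
    [IsManifold (𝓡 3) ∞ Y] [T2Space Y] [SecondCountableTopology Y] [ConnectedSpace Y]
    (e : InitialDataSet (𝓡 3) Y) : Prop :=
  e ∈ admissibleVacuumData Y ∧
    ∃ 𝒟 : VacuumCauchyDevelopment e, 𝒟.IsMaximal ∧
      ∃ (A : 𝓑.AdaptedChart) (Ψ : A.background.domain → 𝒟.carrier),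
        ChartIsAsymptoticallyCartesian A ∧
        ContMDiff 𝓘(ℝ, E4) (𝓡 4) ∞ Ψ ∧ Function.Injective Ψ ∧
          (∀ R : ℝ, ∀ᶠ τ in atBot,
            Ψ '' A.background.truncTimeSlab R τ ⊆
              𝒟.metric.chronologicalPast 𝒟.timeOrientation (Set.range 𝒟.embed)) ∧
          (∃ C : ℝ, ∀ τ : ℝ, τ ≤ 0 →
            𝒟.toSpacetime.deviationCk A.background Ψ 2 τ ≤
              ENNReal.ofReal (C * Real.exp (ν * τ))) ∧
          ∃ τ : ℝ, 𝒟.toSpacetime.deviationCk A.background Ψ 2 τ ≠ 0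

end Holes

section Settling

variable {X : Type} [TopologicalSpace X] [ChartedSpace E3 X] [IsManifold (𝓡 3) ∞ X]
  [T2Space X] [SecondCountableTopology X] [ConnectedSpace X] {D : InitialDataSet (𝓡 3) X}

/-- **The development `𝒟` settles exhaustively to the admissible stationary holes of `sd`**: the
stationary final-state decomposition `sd` (`StationaryFinalStateDecomposition … 1`, i.e. in `C¹`:
`N` holes `sd.hole i : StationaryAFBlackHole` read in `T`-adapted charts, moving apart, plus a flat
radiation zone — `C¹` and NOT the summit's `C²`, because admissibility controls only `(2,1)`
weighted derivatives of the datum at `i⁰`, which protects late-time `C¹` but not `C²`: Disproof §7,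
far-field focusing packets make every pointwise `C²` settling statement over `admissibleVacuumData`
false on a DR-dense set, while `C¹` settling survives them; the upgrade to `C²` is paid by the stubs
that PRODUCE escape curves, 3 and 7, which may clean the far field along the curve) is carried by
the self-determined exterior `O = J⁺(ι X) ∩ I⁻(charted)` of the summit, its
charts exhaust `O` (the summit's clause, ruling F2), every limit hole lies in the telescope of
the route's target (`InTelescope`: vacuum, connected non-degenerate horizon, globally hyperbolic,
`T ≠ 0` on the d.o.c.), and the adapted charts are HORIZON-PENETRATING (they cover `𝓗⁺`, hence an
open neighbourhood of `d.o.c. ∪ 𝓗⁺`, as the DHRT / Klainerman–Szeftel convergence statements do;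
this is what the red-shift and the horizon-regular modes of stubs 4–7 are read in) and
ASYMPTOTICALLY CARTESIAN WITH SPACELIKE LEAVES (`ChartIsAsymptoticallyCartesian`; the far parts of
the hole charts are junk for the convergence clauses, so this only asks the limit holes to be
presented in good charts — it hands stub 6 the cross-section of the `T`-action it needs). -/
def SettlesTo (𝒟 : VacuumCauchyDevelopment D) {O : Set 𝒟.carrier}
    (sd : StationaryFinalStateDecomposition 𝒟.toSpacetime O 1) : Prop :=
  O = Summit.FinalStateConjecture.exteriorOf 𝒟.toCauchyDevelopment sd.charted ∧
    sd.HasExhaustiveCharts ∧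
      ∀ i, InTelescope (sd.hole i) ∧ (sd.hole i).horizon ⊆ Set.range (sd.adapted i).toFun ∧
        ChartIsAsymptoticallyCartesian (sd.adapted i)

end Settling

/-! ## §1a The seven stub STATEMENTS as named `Prop`s
(the registered `stub_*` theorems of §1b restate them verbatim, `*_holds` certify the agreement
definitionally, and `Registered.stub_*` are the name-keyed aliases used as the hypotheses of
`StationaryLimitReduction_of` — the native skeleton audit admits a hypothesis by the last name
component of its head; same device as `Summits/ABC/ABC/Cruxes/SomeWindowSaving/Lines/inert-box-collapse.lean`). -/

/-- Statement of stub 1 (`stub_localEscapeSuffices`, docstring there). -/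
def LocalEscapeSuffices : Prop :=
    ∀ (X : Type) [TopologicalSpace X] [ChartedSpace E3 X] [IsManifold (𝓡 3) ∞ X]
      (𝓓 : Set (InitialDataSet (𝓡 3) X)) (P : InitialDataSet (𝓡 3) X → Prop),
      (∀ d ∈ 𝓓, ¬ P d → HasLocalEscape 𝓓 P d) →
        InitialDataSet.IsChristodoulouGeneric 𝓓 P 1

/-- Statement of stub 2 (`stub_settleOrEscape`, docstring there). -/
def SettleOrEscape : Prop :=
    ∀ (X : Type) [TopologicalSpace X] [ChartedSpace E3 X] [IsManifold (𝓡 3) ∞ X] [T2Space X]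
      [SecondCountableTopology X] [ConnectedSpace X],
      ∀ D ∈ admissibleVacuumData X,
        SummitProperty X D ∨
          HasLocalEscape (admissibleVacuumData X) (SummitProperty X) D ∨
            ((∃ 𝒟 : VacuumCauchyDevelopment D, 𝒟.IsMaximal) ∧
              ∀ 𝒟 : VacuumCauchyDevelopment D, 𝒟.IsMaximal →
                Summit.FinalStateConjecture.HasCompleteNullInfinity 𝒟.toCauchyDevelopment ∧
                  ∃ (O : Set 𝒟.carrier) (sd : StationaryFinalStateDecomposition 𝒟.toSpacetime O 1),
                    SettlesTo 𝒟 sd)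

/-- Statement of stub 3 (`stub_kerrLimitsAreGood`, docstring there). -/
def KerrLimitsAreGood : Prop :=
    ∀ (X : Type) [TopologicalSpace X] [ChartedSpace E3 X] [IsManifold (𝓡 3) ∞ X] [T2Space X]
      [SecondCountableTopology X] [ConnectedSpace X],
      ∀ D ∈ admissibleVacuumData X,
        (∀ 𝒟 : VacuumCauchyDevelopment D, 𝒟.IsMaximal →
          Summit.FinalStateConjecture.HasCompleteNullInfinity 𝒟.toCauchyDevelopment) →
        ∀ 𝒟 : VacuumCauchyDevelopment D, 𝒟.IsMaximal →
          ∀ (O : Set 𝒟.carrier) (sd : StationaryFinalStateDecomposition 𝒟.toSpacetime O 1),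
            SettlesTo 𝒟 sd → (∀ i, IsKerrExterior (sd.hole i)) →
              SummitProperty X D ∨ HasLocalEscape (admissibleVacuumData X) (SummitProperty X) D

/-- Statement of stub 4 (`stub_spinRaisingBridge`, docstring there). -/
def SpinRaisingBridge : Prop :=
    ∀ (𝓑 : StationaryAFBlackHole.{0}) [𝓑.metric.HasLeviCivita],
      InTelescope 𝓑 → ¬ 𝓑.IsKillingModeStable → HasGrowingTensorMode 𝓑

/-- Statement of stub 5 (`stub_topModeGap`, docstring there). -/
def TopModeGap : Prop :=
    ∀ 𝓑 : StationaryAFBlackHole.{0},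
      InTelescope 𝓑 → HasGrowingTensorMode 𝓑 → ∃ ν₁ : ℝ, IsSimpleTopRate 𝓑 ν₁

/-- Statement of stub 6 (`stub_oneGoodExplosion`, docstring there). -/
def OneGoodExplosion : Prop :=
    ∀ 𝓑 : StationaryAFBlackHole.{0}, InTelescope 𝓑 →
      (∃ A₀ : 𝓑.AdaptedChart, 𝓑.horizon ⊆ Set.range A₀.toFun ∧ ChartIsAsymptoticallyCartesian A₀) →
        ¬ IsKerrExterior 𝓑 → ∀ ν₁ : ℝ, IsSimpleTopRate 𝓑 ν₁ →
        ∃ (Y : Type) (_ : TopologicalSpace Y) (_ : ChartedSpace E3 Y) (_ : IsManifold (𝓡 3) ∞ Y)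
          (_ : T2Space Y) (_ : SecondCountableTopology Y) (_ : ConnectedSpace Y)
          (e : InitialDataSet (𝓡 3) Y), IsExplosionExit 𝓑 ν₁ Y e ∧ SummitProperty Y e

/-- Statement of stub 7 (`stub_lockedEscape`, docstring there). -/
def LockedEscape : Prop :=
    ∀ (X : Type) [TopologicalSpace X] [ChartedSpace E3 X] [IsManifold (𝓡 3) ∞ X] [T2Space X]
      [SecondCountableTopology X] [ConnectedSpace X],
      ∀ D ∈ admissibleVacuumData X, ∀ 𝒟 : VacuumCauchyDevelopment D, 𝒟.IsMaximal →
        ∀ (O : Set 𝒟.carrier) (sd : StationaryFinalStateDecomposition 𝒟.toSpacetime O 1),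
          SettlesTo 𝒟 sd → (∃ i, ¬ IsKerrExterior (sd.hole i)) →
            (∀ i, ¬ IsKerrExterior (sd.hole i) →
              ∃ ν₁ : ℝ, IsSimpleTopRate (sd.hole i) ν₁ ∧
                ∃ (Y : Type) (_ : TopologicalSpace Y) (_ : ChartedSpace E3 Y)
                  (_ : IsManifold (𝓡 3) ∞ Y) (_ : T2Space Y) (_ : SecondCountableTopology Y)
                  (_ : ConnectedSpace Y) (e : InitialDataSet (𝓡 3) Y),
                  IsExplosionExit (sd.hole i) ν₁ Y e ∧ SummitProperty Y e) →
              HasLocalEscape (admissibleVacuumData X) (SummitProperty X) D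

/-! ## §1b Registered stubs (`sorry` lives only in these seven theorems) -/

/-- **stub 1 · LOCAL ESCAPE SUFFICES** (card "First lemma"; size M, provable now).
Christodoulou genericity of codimension `1` inside `𝓓` follows as soon as through every exceptional
admissible datum there is an admissible smooth injective curve whose members are good on a
PUNCTURED NEIGHBOURHOOD of the parameter `0`: precompose the curve with the smooth injective
contraction `θ(c) = (ε/2)(1 + ‖c‖²)^{-1/2} c` of `ℝ¹` (`IsSmoothDataFamily` is `ContMDiff` on
`ℝ¹ × X`, stable under `θ × id`; injectivity, `F 0 = d` and admissibility are kept, and every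
`c ≠ 0` lands in the good punctured ball). Why plausibly true: it is a reparametrisation lemma;
checked by all three triagers. Leans on: `InitialDataSet.IsChristodoulouGeneric`,
`HasCodimAtLeastIn`, `IsSmoothDataFamily` (Genericity.lean). -/
theorem stub_localEscapeSuffices :
    ∀ (X : Type) [TopologicalSpace X] [ChartedSpace E3 X] [IsManifold (𝓡 3) ∞ X]
      (𝓓 : Set (InitialDataSet (𝓡 3) X)) (P : InitialDataSet (𝓡 3) X → Prop),
      (∀ d ∈ 𝓓, ¬ P d → HasLocalEscape 𝓓 P d) →
        InitialDataSet.IsChristodoulouGeneric 𝓓 P 1 := by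
  sorry

/-- **stub 2 · SETTLE OR ESCAPE** (the large-data front end every stationary-limit line owes —
weak cosmic censorship, settling to stationary states, dynamical third law / no parking — in the
pointwise TRICHOTOMY form that Disproof §5 permits; size: open problem).
Every admissible datum `D` either (a) already has the summit property, or (b) escapes locally into
it (one admissible smooth injective curve through `D`, good for all small parameters `≠ 0`: the
exit for threshold data of critical collapse, for data whose developments form naked singularities
or park at extremality — expected of positive codimension and two-sidedly avoidable, Christodoulou
1999; Kehle–Unger arXiv:2402.10190 for the extremal threshold), or (c) has a maximal vacuum Cauchy
development, and ALL its MGHDs have complete `𝓘⁺` and settle exhaustively IN `C¹` (`SettlesTo`,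
see there for why `C¹`: Disproof §7) to finitely many ADMISSIBLE stationary vacuum holes — holes in
the telescope of `KerrOrBomb` (vacuum, connected non-degenerate horizon with its Hawking field,
globally hyperbolic, `T ≠ 0` on the d.o.c.) — moving apart plus radiation. No Kerr-ness, no
stability of the limit and no `C²` control is asserted: the limit holes may be bombs (stubs 4–7) and
the datum may carry far-field junk (cleaned by stubs 3 and 7 along their curves); in particular
data `D + focusing packets` (Disproof §7) belong to (c), not to (b), so (b) never has to eject a
bomb. Why it might fail / plausibly true: it is WCC + "generic developments settle to stationary
states" + a generic third law, i.e. the folklore final-state picture minus black-hole uniqueness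
(Dafermos–Luk arXiv:1710.01722 §1.2.1, p. 8: conditional exactly on removing analyticity from
no-hair), weakened to `C¹` so that it is not pointwise refutable by far-field roughness; if smooth
no-hair holds it is the summit minus `stub_kerrLimitsAreGood`. Leans on:
`choquetBruhat_geroch_exists_mghd_cauchy` (MGHD conjunct, named fact),
`StationaryFinalStateDecomposition`, the summit's `HasCompleteNullInfinity`, `exteriorOf`,
`HasExhaustiveCharts`. -/
theorem stub_settleOrEscape :
    ∀ (X : Type) [TopologicalSpace X] [ChartedSpace E3 X] [IsManifold (𝓡 3) ∞ X] [T2Space X]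
      [SecondCountableTopology X] [ConnectedSpace X],
      ∀ D ∈ admissibleVacuumData X,
        SummitProperty X D ∨
          HasLocalEscape (admissibleVacuumData X) (SummitProperty X) D ∨
            ((∃ 𝒟 : VacuumCauchyDevelopment D, 𝒟.IsMaximal) ∧
              ∀ 𝒟 : VacuumCauchyDevelopment D, 𝒟.IsMaximal →
                Summit.FinalStateConjecture.HasCompleteNullInfinity 𝒟.toCauchyDevelopment ∧
                  ∃ (O : Set 𝒟.carrier) (sd : StationaryFinalStateDecomposition 𝒟.toSpacetime O 1),
                    SettlesTo 𝒟 sd) := by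
  sorry

/-- **stub 3 · KERR LIMITS ARE GOOD** (the route's foreseen `KerrChartTransfer`, plus the `C¹ → C²`
upgrade that Disproof §7 forces on every settling line; size XL).
If a maximal development of `D` settles exhaustively in `C¹` (`SettlesTo`) to admissible holes EACH
of which is a fact-free sub-extremal Kerr exterior (`IsKerrExterior`, the conclusion format of
`KerrOrBomb`), and all MGHDs of `D` have complete `𝓘⁺`, then `D` has the summit property OR escapes
locally into it. Content: (i) CHART TRANSFER (StationaryFinalStateDecomposition.lean, "What is NOT
proved here"): make each abstract isometry future-preserving and `T`-EQUIVARIANT using the isometry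
group of the Kerr exterior (`Ψ_* ∂_{t*} = c T`, `c > 0`; undo the Boyer–Lindquist reflection),
re-adapt the late charts, cut the collars, `toFinalStateDecomposition` (`IsKerr`) with its transfer
lemmas; (ii) UPGRADE: for a far-regular datum (all DR-weighted derivatives at `i⁰`, e.g. Kerr outside
a compact set) `C¹` exhaustive settling to sub-extremal Kerrs is `C²` settling (no high-frequency
supply: propagation of far-field regularity for the Einstein flow, or capture — Cauchy stability on
a late slab + sub-extremal Kerr stability, H2 = sibling item `PhaseMixingCapture.BulkKerrCapture`,
`klainerman_szeftel_kerr_stability_small_a_cauchy` for `|a| ≪ M`) ⇒ `SummitProperty`;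
(iii) CLEANING: a general admissible datum is joined to far-regular ones by the admissible smooth
injective curve `c ↦` (Kerr end glued outside radius `ρ(c) = e^{2/c²}`, Corvino–Schoen
gr-qc/0301071 / Chruściel–Delay), whose members' developments agree with `D`'s on the domain of
dependence of the ball and are captured as in (ii) ⇒ `HasLocalEscape`. Why it might fail: (ii) is
sub-extremal Kerr stability from `C¹`-closeness on compact near zones (the weak-vs-stability-norm
gap, triage r1-2 (b)); the growing-radius exhaustive clause must survive re-adaptation. Leans on:
`AdaptedChart.IsKerr`, `toFinalStateDecomposition`, `isSubextremal_/charted_/hasExhaustiveCharts_toFinalStateDecomposition`,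
`AFEnd.IsStronglyAsymptoticallyFlatWith`, `ApproximateKerrConfiguration`, `HasLocalEscape`. -/
theorem stub_kerrLimitsAreGood :
    ∀ (X : Type) [TopologicalSpace X] [ChartedSpace E3 X] [IsManifold (𝓡 3) ∞ X] [T2Space X]
      [SecondCountableTopology X] [ConnectedSpace X],
      ∀ D ∈ admissibleVacuumData X,
        (∀ 𝒟 : VacuumCauchyDevelopment D, 𝒟.IsMaximal →
          Summit.FinalStateConjecture.HasCompleteNullInfinity 𝒟.toCauchyDevelopment) →
        ∀ 𝒟 : VacuumCauchyDevelopment D, 𝒟.IsMaximal →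
          ∀ (O : Set 𝒟.carrier) (sd : StationaryFinalStateDecomposition 𝒟.toSpacetime O 1),
            SettlesTo 𝒟 sd → (∀ i, IsKerrExterior (sd.hole i)) →
              SummitProperty X D ∨ HasLocalEscape (admissibleVacuumData X) (SummitProperty X) D := by
  sorry

/-- **stub 4 · SPIN-RAISING BRIDGE** (card `SpinRaisingBridge` = Disproof §6 note 1 option (b);
the load-bearing unknown of the line; size: open).
An admissible stationary vacuum hole (telescope of the target) which is NOT Killing-mode stable for
the SCALAR wave operator `□_g` — this is what `KerrOrBomb` hands over for a non-Kerr limit hole —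
carries an exponentially growing Killing mode of LINEARISED GRAVITY: a tensor Killing-mode pair
`(h₁, h₂)`, `ν > 0`, smooth across `𝓗⁺`, outgoing, solving `DRic_g(hᵢ) = 0`, not pure gauge
(`HasGrowingTensorMode`, typed with the full side conditions: triage r1-1 (a), r1-3 (a) — without
horizon regularity Kerr itself would have radial "growing modes"). Why it might fail: vacuum
dynamics is blind to test scalars (linearised Einstein–scalar about `(𝓑, 0)` decouples; `∇∇u` of a
scalar mode is pure gauge); a scalar-unstable but gravitationally mode-stable vacuum hole kills it
(and makes `KerrOrBomb` true with the summit false). Why plausibly true: the mechanism that makes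
a MASSLESS scalar grow on an AF vacuum hole (superradiant gain × geometric confinement `Γ₀`) is
spin-blind at high frequency — Gaussian beams of linearised gravity ride the same trapped
zero/negative-energy rays with the same horizon flux — and every computed family bombs for
`s = 0, 1, 2` alike (Press–Teukolsky mirror bomb, small Kerr–AdS: Cardoso–Dias–Lemos–Yoshida
hep-th/0404096, Cardoso–Dias hep-th/0405006; ergoregion instability of stars: Friedman 1978,
Comins–Schutz 1978, Moschidis arXiv:1608.02035); in `t–φ`-symmetric sectors negative canonical
energy gives gravitational growth directly (Hollands–Wald arXiv:1201.0463, Prabhu–Wald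
arXiv:1501.02522). The spin-blind factorisation `Γ₀ ≠ ∅ ⇒ tensor quasimodes ⇒ tensor bomb`
(SketchIdeator1 `WhitingFromGeometry` + crux 3 `ErgoregionBomb` at spin 2) is the intended proof
route. Leans on: `IsKillingModeStable` (Iff.rfl with the target's telescope), `linearizedRicciCLM`,
`lieDerivBilin`, `AFEnd.dataChart`. -/
theorem stub_spinRaisingBridge :
    ∀ (𝓑 : StationaryAFBlackHole.{0}) [𝓑.metric.HasLeviCivita],
      InTelescope 𝓑 → ¬ 𝓑.IsKillingModeStable → HasGrowingTensorMode 𝓑 := by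
  sorry

/-- **stub 5 · TOP-MODE GAP** (hypothesis H1 of the card = `TopModeGap` of the merged card
`escape-along-the-explosion`; kept explicit on the triagers' instruction, r1-1 (c), r1-2 (c),
r1-3 (b); size L/XL).
The unstable tensor Killing spectrum of an admissible hole with a growing mode has an ATTAINED,
ISOLATED and SIMPLE maximum: some rate `ν₁` is realised by a non-gauge pair, no non-gauge pair has a
rate in `(ν₁ − δ, ν₁) ∪ (ν₁, ∞)`, and at rate `ν₁` the frequencies are `±ω₁` with eigenspace one
complex line modulo gauge (`IsSimpleTopRate`). Why it might fail: nothing of the kind is in print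
for smooth AF holes — Warnick (CMP 333 (2015)) / Gajic–Warnick (arXiv:1910.08479, p. 19) give
discreteness with finite multiplicity in sectors but allow accumulation at the sector boundary; a
superradiant tower whose rates INCREASE to a non-attained supremum, an accumulation of rates
`≥ ε` at `|Im s| → ∞`, or a symmetry-degenerate top plane (then `W^{uu}` is a torus' worth, not a
circle) each kill single-explosion dominance. Why plausibly true: on a `κ > 0` hole growing modes
are `e^{-(Re s) r}`-localised and horizon-regular, so the stationary family `P(s)` is analytic
Fredholm on `{Re s ≥ ε}` in regular slicings with no Gevrey machinery at `𝓘⁺`; high frequencies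
see no `O(1)` gain at `κ > 0`, so rates accumulate only at `0` (for the Press–Teukolsky bomb and
small Kerr–AdS the rates DEcrease in `m`, `ℓ`: hep-th/0404096, Table I); simplicity is generic and
can be relaxed to semisimplicity by locking on a torus. Leans on: `IsTensorModePair`,
`IsPureGaugeOnDoc`. -/
theorem stub_topModeGap :
    ∀ 𝓑 : StationaryAFBlackHole.{0},
      InTelescope 𝓑 → HasGrowingTensorMode 𝓑 → ∃ ν₁ : ℝ, IsSimpleTopRate 𝓑 ν₁ := by
  sorry

/-- **stub 6 · ONE GOOD EXPLOSION PER BOMB** (the card's fate statement, point (3) of "Why it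
bites"; size XL / open).
For every admissible NON-KERR hole `𝓑` presented in a horizon-penetrating, asymptotically Cartesian,
spacelike-leaved `T`-adapted chart (as the limit holes of `SettlesTo` are) and with simple top rate
`ν₁`, there is an exit datum `e` of a top-mode explosion of `𝓑` (`IsExplosionExit 𝓑 ν₁ Y e`: admissible vacuum datum on some `3`-manifold
`Y` whose MGHD converges to `𝓑` in a `T`-adapted chart as chart time `→ −∞`, in the past of
`ι(Y)`, at rate `e^{ν₁ t}`, non-trivially) which ITSELF has the summit property: complete `𝓘⁺` and
an exhaustive sub-extremal Kerr final state. Two halves: EXISTENCE of the explosion circle (the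
strong-unstable manifold of the top complex pair for the Einstein vacuum flow near `𝓑` in a
`T`-adapted horizon-penetrating gauge — the unstable-side twin of DHRT's codimension-3 stable
"submanifold", arXiv:2104.08222; only finite backward windows and the gap `δ` of stub 5 are used,
no decay estimate on `𝓑`; the interior of the hole is filled in to make `e` complete and one-ended)
and FATE of ONE member `e_{θ*}` of the circle (ours to choose). Why it might fail: every explosion
of `𝓑` could be heteroclinic to another bomb, creep to extremality or form a naked singularity —
nothing known excludes a bomb all of whose explosions are exceptional. Why plausibly true: good
fates are OPEN on the circle while each exceptional fate is expected of positive codimension, so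
"∃ θ" fails only if the whole circle is exceptional; explosions carry the monotone budgets
`M_Bondi ↓` (strictly: a non-radiating explosion is stationary by Liouville, hence `= 𝓑`) and
`A_𝓗 ↑`, so they never return to `𝓑` and "ends in the Kerr basin" can be attacked by induction on
the budget lattice over the moduli of admissible holes (Bizoń gr-qc/9402016 'weak no-hair'; the
colored-black-hole precedent Straumann–Zhou 1990 / Zhou–Straumann 1991, where both kicked fates
are good). Leans on: `AdaptedChart`, `truncDeviationCk`, `VacuumCauchyDevelopment.IsMaximal`,
`admissibleVacuumData`, `SummitProperty`. -/
theorem stub_oneGoodExplosion :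
    ∀ 𝓑 : StationaryAFBlackHole.{0}, InTelescope 𝓑 →
      (∃ A₀ : 𝓑.AdaptedChart, 𝓑.horizon ⊆ Set.range A₀.toFun ∧ ChartIsAsymptoticallyCartesian A₀) →
        ¬ IsKerrExterior 𝓑 → ∀ ν₁ : ℝ, IsSimpleTopRate 𝓑 ν₁ →
        ∃ (Y : Type) (_ : TopologicalSpace Y) (_ : ChartedSpace E3 Y) (_ : IsManifold (𝓡 3) ∞ Y)
          (_ : T2Space Y) (_ : SecondCountableTopology Y) (_ : ConnectedSpace Y)
          (e : InitialDataSet (𝓡 3) Y), IsExplosionExit 𝓑 ν₁ Y e ∧ SummitProperty Y e := by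
  sorry

/-- **stub 7 · LOCKED ESCAPE** (the card's lever (i) EJECTION + (ii) PHASE-LOCKING, plus far-field
cleaning and capture; size XL).
Let the admissible datum `D` have a maximal development settling exhaustively in `C¹` (`SettlesTo`)
to admissible holes, at least one of them not Kerr, and suppose every non-Kerr limit hole `𝓑ᵢ` comes
with a simple top rate `νᵢ` and a CHOSEN good top-mode explosion exit `eᵢ` (the outputs of stubs
5–6). Then `D` escapes locally: there is an admissible smooth injective curve through `D` all of
whose members with small parameter `s ≠ 0` have the summit property. Mechanism: (F) far-field
cleaning along the curve — glue an exact Kerr end outside the radius `ρ(s) = e^{2/s²}`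
(Corvino–Schoen gr-qc/0301071; flat-small in `s`, `≪` the kick `e^{-1/s²}`, so it does not move the
exit phase), which makes the members far-regular and immune to the focusing packets of Disproof §7
while leaving the development unchanged on the domain of dependence of the ball; (T) transversality
— a compactly supported constraint-solving kick at `t = 0` (Carlotto–Schoen arXiv:1407.4766,
localised inside `admissibleVacuumData`) whose linear propagation pairs non-trivially with the dual
top mode of each `𝓑ᵢ` (Moncrief splitting / Burnett–Wald current: crux idea
`symplectic-dual-of-the-bomb`); (E) ejection — `λ`-lemma for the Einstein flow near each `𝓑ᵢ`
(Nakanishi–Schlag arXiv:1005.4894 one-pass/ejection template; finite windows, high regularity,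
loss paid once per window, and the semigroup bound `‖e^{tL}(1 − P_top)‖ ≲ e^{(νᵢ−δ)t}` on the line
`Re s = νᵢ − δ > 0`, where resolvent bounds do not see trapping — triage r1-3 (c); the polynomial
tail of `D`'s own convergence contributes a convergent, hence lockable, phase offset — r1-1 (d));
(L) the lock — reparametrise by the flat `c = e^{-1/s²}` and rotate the kick by the compensating
phase `α/s²`, `α = −ωᵢ/νᵢ` (`FlatPhaseLocking`: `s ↦ e^{-1/s²} cos(α/s²)` is `C^∞`, Mathlib-level),
with an odd flat term `s e^{-1/s²} w₃` for injectivity, so that for ALL small `s ≠ 0` the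
development shadows, near each `𝓑ᵢ`, the fixed chosen explosion `eᵢ` on every finite window
(exit phase `θ(s) = α/s² + (ωᵢ/νᵢ)/s² + O(e^{-δ'/s²})` is constant); (C) capture — each `eᵢ`
reaches its sub-extremal Kerr end state in finite time, Kerr limit holes stay Kerr, so a late slab
of the kicked development is an `ε`-approximate `N`-Kerr configuration with receding holes
(`ApproximateKerrConfiguration`), and Cauchy stability on the compact stretch plus asymptotic
stability of sub-extremal Kerr (H2: Klainerman–Szeftel arXiv:2104.11857 / GKS arXiv:2205.14808 for
`|a| ≪ M`, `klainerman_szeftel_kerr_stability_small_a_cauchy`; full range claimed by Hintz 2026;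
the weak-vs-stability-norm gap of triage r1-2 (b) lives here) give the summit property, including
complete `𝓘⁺`. Why it might fail: derivative loss at the unknown trapping of `𝓑ᵢ`
(`Literature.Barriers.FinalStateConjecture.TrappingDerivativeLoss`) inside (E); the multi-hole
capture in (C) is itself unproved for `N ≥ 2`; the `C¹` settling input must be upgraded near each
`𝓑ᵢ` after cleaning (no high-frequency supply for far-regular data). Leans on: `HasLocalEscape`,
`IsSimpleTopRate`, `IsExplosionExit`, `SettlesTo`, `IsSmoothDataFamily`,
`ApproximateKerrConfiguration`, `AFEnd.IsStronglyAsymptoticallyFlatWith`. -/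
theorem stub_lockedEscape :
    ∀ (X : Type) [TopologicalSpace X] [ChartedSpace E3 X] [IsManifold (𝓡 3) ∞ X] [T2Space X]
      [SecondCountableTopology X] [ConnectedSpace X],
      ∀ D ∈ admissibleVacuumData X, ∀ 𝒟 : VacuumCauchyDevelopment D, 𝒟.IsMaximal →
        ∀ (O : Set 𝒟.carrier) (sd : StationaryFinalStateDecomposition 𝒟.toSpacetime O 1),
          SettlesTo 𝒟 sd → (∃ i, ¬ IsKerrExterior (sd.hole i)) →
            (∀ i, ¬ IsKerrExterior (sd.hole i) →
              ∃ ν₁ : ℝ, IsSimpleTopRate (sd.hole i) ν₁ ∧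
                ∃ (Y : Type) (_ : TopologicalSpace Y) (_ : ChartedSpace E3 Y)
                  (_ : IsManifold (𝓡 3) ∞ Y) (_ : T2Space Y) (_ : SecondCountableTopology Y)
                  (_ : ConnectedSpace Y) (e : InitialDataSet (𝓡 3) Y),
                  IsExplosionExit (sd.hole i) ν₁ Y e ∧ SummitProperty Y e) →
              HasLocalEscape (admissibleVacuumData X) (SummitProperty X) D := by
  sorry


/-! ### Consistency: each named statement IS its registered stub (definitionally) -/

theorem localEscapeSuffices_holds : LocalEscapeSuffices := stub_localEscapeSuffices
theorem settleOrEscape_holds : SettleOrEscape := stub_settleOrEscape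
theorem kerrLimitsAreGood_holds : KerrLimitsAreGood := stub_kerrLimitsAreGood
theorem spinRaisingBridge_holds : SpinRaisingBridge := stub_spinRaisingBridge
theorem topModeGap_holds : TopModeGap := stub_topModeGap
theorem oneGoodExplosion_holds : OneGoodExplosion := stub_oneGoodExplosion
theorem lockedEscape_holds : LockedEscape := stub_lockedEscape

/-! ### Name-keyed aliases of the statements (the hypotheses of the composition) -/
namespace Registered

/-- Alias of `LocalEscapeSuffices` keyed by the registered stub name. -/
abbrev stub_localEscapeSuffices : Prop := LocalEscapeSuffices
/-- Alias of `SettleOrEscape` keyed by the registered stub name. -/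
abbrev stub_settleOrEscape : Prop := SettleOrEscape
/-- Alias of `KerrLimitsAreGood` keyed by the registered stub name. -/
abbrev stub_kerrLimitsAreGood : Prop := KerrLimitsAreGood
/-- Alias of `SpinRaisingBridge` keyed by the registered stub name. -/
abbrev stub_spinRaisingBridge : Prop := SpinRaisingBridge
/-- Alias of `TopModeGap` keyed by the registered stub name. -/
abbrev stub_topModeGap : Prop := TopModeGap
/-- Alias of `OneGoodExplosion` keyed by the registered stub name. -/
abbrev stub_oneGoodExplosion : Prop := OneGoodExplosion
/-- Alias of `LockedEscape` keyed by the registered stub name. -/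
abbrev stub_lockedEscape : Prop := LockedEscape

end Registered

/-! ## §2 The kernel-checked composition -/

/-- **The line concludes the crux.** From the seven stubs (hypotheses `Registered.stub_…`, the
name-keyed aliases of the statements of §1a), `StationaryLimitReduction` — i.e.
`KerrOrBomb → FinalStateConjecture` — by logic: reduce genericity to local escape (stub 1); a bad
datum cannot have the summit property, so by stub 2 it escapes or its MGHD settles in `C¹` to
admissible holes; if every limit hole is a Kerr exterior, stub 3 gives the summit property
(contradiction) or an escape; otherwise some limit hole is not Kerr, hence by `KerrOrBomb` (instantiated with
the tree theorems `kerrFacts` and `hasLeviCivita`) NOT Killing-mode stable, hence (stub 4) carries a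
growing tensor mode, hence (stub 5) a simple top rate, hence (stub 6) a good top-mode explosion; the
lock (stub 7) turns these choices into a local escape. -/
theorem StationaryLimitReduction_of
    (h₁ : Registered.stub_localEscapeSuffices)
    (h₂ : Registered.stub_settleOrEscape)
    (h₃ : Registered.stub_kerrLimitsAreGood)
    (h₄ : Registered.stub_spinRaisingBridge)
    (h₅ : Registered.stub_topModeGap)
    (h₆ : Registered.stub_oneGoodExplosion)
    (h₇ : Registered.stub_lockedEscape) :
    Summit.FinalStateConjecture.FinalStateConjecture.Theses.ZeroEnergyKerrOrBomb.StationaryLimitReduction := by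
  intro hKOB X _ _ _ _ _ _
  refine h₁ X (admissibleVacuumData X) (SummitProperty X) ?_
  intro D hD hbad
  rcases h₂ X D hD with hP | hesc | ⟨⟨𝒟, hmax⟩, hall⟩
  · exact absurd hP hbad
  · exact hesc
  · obtain ⟨-, O, sd, hset⟩ := hall 𝒟 hmax
    by_cases hK : ∀ i, IsKerrExterior (sd.hole i)
    · rcases h₃ X D hD (fun 𝒟' h' ↦ (hall 𝒟' h').1) 𝒟 hmax O sd hset hK with hP | hesc
      · exact absurd hP hbad
      · exact hesc
    · obtain ⟨i, hi⟩ := not_forall.mp hK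
      refine h₇ X D hD 𝒟 hmax O sd hset ⟨i, hi⟩ ?_
      intro j hj
      have htel : InTelescope (sd.hole j) := (hset.2.2 j).1
      haveI : (sd.hole j).metric.HasLeviCivita :=
        (sd.hole j).metric.toPseudoRiemannianMetric.hasLeviCivita
      have hunst : ¬ (sd.hole j).IsKillingModeStable := by
        intro hst
        apply hj
        haveI : Kerr.Facts := kerrFacts
        obtain ⟨hRic, hconn, hnd, hgh, hT⟩ := htel
        exact hKOB (sd.hole j) hRic hconn hnd hgh hT
          (((sd.hole j).isKillingModeStable_iff).mp hst)
      obtain ⟨ν₁, htop⟩ := h₅ _ htel (h₄ _ htel hunst)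
      exact ⟨ν₁, htop, h₆ _ htel ⟨sd.adapted j, (hset.2.2 j).2.1, (hset.2.2 j).2.2⟩ hj ν₁ htop⟩

end Summit.FinalStateConjecture.FinalStateConjecture.Cruxes.StationaryLimitReduction.OneLockedExplosion

end
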